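import Summits.Ventures.DiscreteObjects.PP12.OrderElevenTriangleLemmas

/-!
# PP(12), order-11 cell, Case B (triangle): unique decomposition of the free points (kernel; proofs)
Framing: lottery ticket; floor = certified bounds/negative ranges.

Cell pub-namedobj (venture DiscreteObjects), target (M), designs gen 16. Setting and notation of `OrderElevenTriangleFrame`. Proved here:
* `pow_apply_mod_inj`: for a point/line moved by every `τ^k` (`11 ∤ k`, `τ¹¹ = 1`), `τ^a x = τ^b x → a ≡ b (mod 11)`;
* `P_t` is free (`fp11_free`) and **`σ^t P_t ∈ M_1`** (`pow_t_fp11_mem_pm1`); the three vertex pencils are `{σ^y M_k}` (`pencil0/1/2`);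
* **unique decomposition** `free_decomp` / `free_decomp_unique`: every free point is `σ^x P_t` for exactly one `(t, x) ∈ Fin 11 × Fin 11`;
* `orbit_meets_once11`: an orbit avoiding `v` meets a line `M ∋ v` moved by all powers in a single exponent class mod 11;
* the epsilon exponents of `triData11` are genuine: `phiN11_spec` (`phi t < 11`, `σ^{phi t} P_t ∈ M_2`), `g1N11_spec`, `g2N11_spec`.
Proofs only; nothing asserts any census statement. No `sorry`, no new axioms.
-/

namespace Summit.Ventures.DiscreteObjects.PP12

open Configuration Finset
open scoped Classical

section Perm

variable {α : Type*}

/-- `τ¹¹ = 1` and `x` moved by every `τ^k`, `11 ∤ k`: `τ^a x = τ^b x` forces `a ≡ b (mod 11)`. -/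
theorem pow_apply_mod_inj (τ : Equiv.Perm α) (h : τ ^ 11 = 1) {x : α} (hmov : ∀ k : ℕ, ¬ 11 ∣ k → (τ ^ k) x ≠ x) {a b : ℕ}
    (hab : (τ ^ a) x = (τ ^ b) x) : a % 11 = b % 11 := by
  rw [pow_apply_eq_pow_mod τ h a, pow_apply_eq_pow_mod τ h b] at hab
  by_contra hne
  have key : ∀ c d : ℕ, c < d → d < 11 → (τ ^ c) x = (τ ^ d) x → False := by
    intro c d hcd hd hfix
    have e' : (τ ^ c) x = (τ ^ c) ((τ ^ (d - c)) x) := by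
      rw [← Equiv.Perm.mul_apply, ← pow_add, show c + (d - c) = d by omega]; exact hfix
    exact hmov (d - c) (by omega) ((τ ^ c).injective e').symm
  rcases Nat.lt_or_gt_of_ne hne with hlt | hlt
  · exact key _ _ hlt (Nat.mod_lt b (by norm_num)) hab
  · exact key _ _ hlt (Nat.mod_lt a (by norm_num)) hab.symm

end Perm

namespace Collineation

variable {P L : Type*} [Membership P L] (σ : Collineation P L) [ProjectivePlane P L] [Fintype P] [Fintype L]

section ElevenB

variable (h12 : ProjectivePlane.order P L = 12) (hq : σ.onPoints ^ 11 = 1)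
  (hB : ∀ l : L, σ.onLines l = l → ∀ [DecidablePred (· ∈ l)], σ.fixedOnLine l = 2)

/-! ### The base free points `P_t` -/

omit [ProjectivePlane P L] [Fintype P] [Fintype L] in
/-- a vertex lies on `σ^k M` iff on `M` -/
theorem tv_mem_pow_iff {v : P} (fv : σ.onPoints v = v) (k : ℕ) (M : L) : v ∈ (σ.onLines ^ k) M ↔ v ∈ M := by
  conv_lhs => rw [← Equiv.Perm.pow_apply_eq_self_of_apply_eq_self fv k]
  exact σ.pow_mem_iff k v M

/-- **`P_t` is free** -/
theorem fp11_free (t : Fin 11) : σ.fp11 h12 hq hB t ∈ σ.freePts h12 hq hB := by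
  have T := σ.tv_spec h12 hq hB
  refine σ.free_of_mem_pm0 h12 hq hB (σ.fp11_mem_pm0 h12 hq hB t) (fun e => ?_) (fun e => ?_)
  · have h := σ.fp11_mem_pow_pm1 h12 hq hB t
    rw [e, σ.tv_mem_pow_iff T.1] at h
    exact σ.tv0_not_mem_pm1 h12 hq hB h
  · have h := σ.fp11_mem_pow_pm1 h12 hq hB t
    rw [e, σ.mem_pow_apply_iff] at h
    set k := ((-t : Fin 11) : ℕ)
    have h' : (σ.onPoints ^ k).symm (σ.sq0 h12 hq hB) ∈ σ.sd0 h12 hq hB :=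
      σ.pow_symm_apply_mem_of_fixed (σ.sd_fixed h12 hq hB).1 (σ.sq0_spec h12 hq hB).1 k
    have ev : (σ.onPoints ^ k).symm (σ.sq0 h12 hq hB) = σ.tv1 h12 hq hB := by
      rcases Nondegenerate.eq_or_eq h (σ.pm_mem h12 hq hB).2.2.1 h' (σ.tv_mem_sd h12 hq hB).1 with e1 | e1
      · exact e1
      · exact absurd (e1 ▸ (σ.tv_mem_sd h12 hq hB).2.1) (σ.tv2_not_mem_pm1 h12 hq hB)
    have : σ.sq0 h12 hq hB = σ.tv1 h12 hq hB := by
      rw [← (σ.onPoints ^ k).apply_symm_apply (σ.sq0 h12 hq hB), ev, Equiv.Perm.pow_apply_eq_self_of_apply_eq_self T.2.1 k]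
    exact (σ.sq0_spec h12 hq hB).2.1 this

/-- `σ^k P_t` is free -/
theorem pow_fp11_free (k : ℕ) (t : Fin 11) : (σ.onPoints ^ k) (σ.fp11 h12 hq hB t) ∈ σ.freePts h12 hq hB :=
  (σ.pow_mem_freePts_iff h12 hq hB k _).2 (σ.fp11_free h12 hq hB t)

/-- a free point is not a vertex -/
theorem ne_tv_of_free {p : P} (hp : p ∈ σ.freePts h12 hq hB) : p ≠ σ.tv0 h12 hq hB ∧ p ≠ σ.tv1 h12 hq hB ∧ p ≠ σ.tv2 h12 hq hB := by
  have M := σ.tv_mem_sd h12 hq hB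
  rw [mem_freePts] at hp
  exact ⟨fun e => hp.2.1 (e ▸ M.2.2.1), fun e => hp.1 (e ▸ M.1), fun e => hp.1 (e ▸ M.2.1)⟩

include hq in
/-- exponent bookkeeping: from `p ∈ σL^a m`, `σ^b p ∈ σL^{(b + a) % 11} m` -/
theorem pow_apply_mem_pow {a b : ℕ} {p : P} {m : L} (h : p ∈ (σ.onLines ^ a) m) :
    (σ.onPoints ^ b) p ∈ (σ.onLines ^ ((b + a) % 11)) m := by
  rw [← pow_apply_eq_pow_mod σ.onLines (σ.onLines_pow_eq_one hq), pow_add, Equiv.Perm.mul_apply]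
  exact (σ.pow_mem_iff b p _).2 h

/-- **`σ^t P_t ∈ M_1`** -/
theorem pow_t_fp11_mem_pm1 (t : Fin 11) : (σ.onPoints ^ (t : ℕ)) (σ.fp11 h12 hq hB t) ∈ σ.pm1 h12 hq hB := by
  have h := σ.pow_apply_mem_pow hq (b := (t : ℕ)) (σ.fp11_mem_pow_pm1 h12 hq hB t)
  have e : ((t : ℕ) + ((-t : Fin 11) : ℕ)) % 11 = 0 := by
    have := Fin.val_add t (-t)
    rw [add_neg_cancel, Fin.val_zero] at this
    exact this.symm
  rwa [e, pow_zero, Equiv.Perm.one_apply] at h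

/-! ### Unique decomposition of the free points -/

/-- lines of the pencil of `v0` other than `S_1, S_2` are `σ^y M_0` -/
theorem pencil0 {ℓ : L} (hv : σ.tv0 h12 hq hB ∈ ℓ) (h1 : ℓ ≠ σ.sd1 h12 hq hB) (h2 : ℓ ≠ σ.sd2 h12 hq hB) :
    ∃ y : ℕ, y < 11 ∧ (σ.onLines ^ y) (σ.pm0 h12 hq hB) = ℓ := by
  have M := σ.tv_mem_sd h12 hq hB
  exact σ.pencil_regular11 h12 (σ.tv_spec h12 hq hB).1 M.2.2.1 M.2.2.2.2.1
    (fun h => σ.tv1_not_mem_sd1 h12 hq hB (h ▸ M.2.2.2.2.2)) (σ.sd_fixed h12 hq hB).2.1 (σ.sd_fixed h12 hq hB).2.2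
    (σ.pm_mem h12 hq hB).1 (fun h => σ.tv2_not_mem_pm0 h12 hq hB (h ▸ M.2.2.2.1)) (fun h => σ.tv1_not_mem_pm0 h12 hq hB (h ▸ M.2.2.2.2.2))
    (fun k hk => (σ.pow_pm_ne h12 hq hB hk).1) hv h1 h2

/-- lines of the pencil of `v1` other than `S_0, S_2` are `σ^y M_1` -/
theorem pencil1 {ℓ : L} (hv : σ.tv1 h12 hq hB ∈ ℓ) (h0 : ℓ ≠ σ.sd0 h12 hq hB) (h2 : ℓ ≠ σ.sd2 h12 hq hB) :
    ∃ y : ℕ, y < 11 ∧ (σ.onLines ^ y) (σ.pm1 h12 hq hB) = ℓ := by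
  have M := σ.tv_mem_sd h12 hq hB
  exact σ.pencil_regular11 h12 (σ.tv_spec h12 hq hB).2.1 M.1 M.2.2.2.2.2
    (fun h => σ.tv0_not_mem_sd0 h12 hq hB (h ▸ M.2.2.2.2.1)) (σ.sd_fixed h12 hq hB).1 (σ.sd_fixed h12 hq hB).2.2
    (σ.pm_mem h12 hq hB).2.2.1 (fun h => σ.tv2_not_mem_pm1 h12 hq hB (h ▸ M.2.1)) (fun h => σ.tv0_not_mem_pm1 h12 hq hB (h ▸ M.2.2.2.2.1))
    (fun k hk => (σ.pow_pm_ne h12 hq hB hk).2.1) hv h0 h2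

/-- lines of the pencil of `v2` other than `S_0, S_1` are `σ^y M_2` -/
theorem pencil2 {ℓ : L} (hv : σ.tv2 h12 hq hB ∈ ℓ) (h0 : ℓ ≠ σ.sd0 h12 hq hB) (h1 : ℓ ≠ σ.sd1 h12 hq hB) :
    ∃ y : ℕ, y < 11 ∧ (σ.onLines ^ y) (σ.pm2 h12 hq hB) = ℓ := by
  have M := σ.tv_mem_sd h12 hq hB
  exact σ.pencil_regular11 h12 (σ.tv_spec h12 hq hB).2.2.1 M.2.1 M.2.2.2.1
    (fun h => σ.tv0_not_mem_sd0 h12 hq hB (h ▸ M.2.2.1)) (σ.sd_fixed h12 hq hB).1 (σ.sd_fixed h12 hq hB).2.1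
    (σ.pm_mem h12 hq hB).2.2.2.2.1 (fun h => σ.tv1_not_mem_pm2 h12 hq hB (h ▸ M.1)) (fun h => σ.tv0_not_mem_pm2 h12 hq hB (h ▸ M.2.2.1))
    (fun k hk => (σ.pow_pm_ne h12 hq hB hk).2.2) hv h0 h1

/-- **Every free point is `σ^x P_t`.** -/
theorem free_decomp {R : P} (hR : R ∈ σ.freePts h12 hq hB) :
    ∃ t x : Fin 11, (σ.onPoints ^ (x : ℕ)) (σ.fp11 h12 hq hB t) = R := by
  have hRF := hR
  rw [mem_freePts] at hR
  have hR0 : σ.tv0 h12 hq hB ≠ R := fun e => hR.2.1 (e ▸ (σ.tv_mem_sd h12 hq hB).2.2.1)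
  -- the pencil-0 line through R
  have hax := HasLines.mkLine_ax (L := L) hR0
  obtain ⟨y, hy, hyℓ⟩ := σ.pencil0 h12 hq hB hax.1 (fun e => hR.2.1 (e ▸ hax.2)) (fun e => hR.2.2 (e ▸ hax.2))
  set p := (σ.onPoints ^ y).symm R with hp
  have hpR : (σ.onPoints ^ y) p = R := (σ.onPoints ^ y).apply_symm_apply R
  have hpM : p ∈ σ.pm0 h12 hq hB := by rw [← σ.pow_mem_iff y, hpR, hyℓ]; exact hax.2
  have hpF : p ∈ σ.freePts h12 hq hB := by rw [← σ.pow_mem_freePts_iff h12 hq hB y, hpR]; exact hRF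
  have hp1 : σ.tv1 h12 hq hB ≠ p := fun e => (σ.ne_tv_of_free h12 hq hB hpF).2.1 e.symm
  -- the pencil-1 line through p
  have hbx := HasLines.mkLine_ax (L := L) hp1
  have hpF' := hpF
  rw [mem_freePts] at hpF'
  obtain ⟨y1, hy1, hy1ℓ⟩ := σ.pencil1 h12 hq hB hbx.1 (fun e => hpF'.1 (e ▸ hbx.2)) (fun e => hpF'.2.2 (e ▸ hbx.2))
  -- t with (-t) = y1
  set t : Fin 11 := fin11 (11 - y1) with ht
  have htneg : ((-t : Fin 11) : ℕ) = y1 := by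
    rw [Fin.val_neg']
    simp only [ht, fin11]
    omega
  have hpt : p = σ.fp11 h12 hq hB t := by
    have h1 : p ∈ (σ.onLines ^ ((-t : Fin 11) : ℕ)) (σ.pm1 h12 hq hB) := by rw [htneg, hy1ℓ]; exact hbx.2
    rcases Nondegenerate.eq_or_eq hpM (σ.fp11_mem_pm0 h12 hq hB t) h1 (σ.fp11_mem_pow_pm1 h12 hq hB t) with e | e
    · exact e
    · exact absurd e (σ.pm0_ne_pow_pm1 h12 hq hB _)
  refine ⟨t, fin11 y, ?_⟩
  rw [fin11_val_of_lt hy, ← hpt, hpR]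

include hq in
/-- exponents below 11 agreeing mod 11 on a moved line are equal -/
theorem fin_eq_of_pow_pm_eq {m : L} (hmov : ∀ k : ℕ, ¬ 11 ∣ k → (σ.onLines ^ k) m ≠ m) {x x' : Fin 11}
    (h : (σ.onLines ^ (x : ℕ)) m = (σ.onLines ^ (x' : ℕ)) m) : x = x' := by
  have e := pow_apply_mod_inj σ.onLines (σ.onLines_pow_eq_one hq) hmov h
  rw [Nat.mod_eq_of_lt x.isLt, Nat.mod_eq_of_lt x'.isLt] at e
  exact Fin.ext e

/-- **… and the pair `(t, x)` is unique.** -/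
theorem free_decomp_unique {t t' x x' : Fin 11}
    (h : (σ.onPoints ^ (x : ℕ)) (σ.fp11 h12 hq hB t) = (σ.onPoints ^ (x' : ℕ)) (σ.fp11 h12 hq hB t')) : t = t' ∧ x = x' := by
  have T := σ.tv_spec h12 hq hB
  -- the pencil-0 lines through the common point
  have h1 : (σ.onPoints ^ (x : ℕ)) (σ.fp11 h12 hq hB t) ∈ (σ.onLines ^ (x : ℕ)) (σ.pm0 h12 hq hB) :=
    (σ.pow_mem_iff _ _ _).2 (σ.fp11_mem_pm0 h12 hq hB t)
  have h2 : (σ.onPoints ^ (x : ℕ)) (σ.fp11 h12 hq hB t) ∈ (σ.onLines ^ (x' : ℕ)) (σ.pm0 h12 hq hB) := by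
    rw [h]; exact (σ.pow_mem_iff _ _ _).2 (σ.fp11_mem_pm0 h12 hq hB t')
  have h3 := (σ.tv_mem_pow_iff T.1 (x : ℕ) (σ.pm0 h12 hq hB)).2 (σ.pm_mem h12 hq hB).1
  have h4 := (σ.tv_mem_pow_iff T.1 (x' : ℕ) (σ.pm0 h12 hq hB)).2 (σ.pm_mem h12 hq hB).1
  have hne : (σ.onPoints ^ (x : ℕ)) (σ.fp11 h12 hq hB t) ≠ σ.tv0 h12 hq hB := (σ.ne_tv_of_free h12 hq hB (σ.pow_fp11_free h12 hq hB _ t)).1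
  have hlines := (Nondegenerate.eq_or_eq h1 h3 h2 h4).resolve_left hne
  have hxx' : x = x' := σ.fin_eq_of_pow_pm_eq hq (fun k hk => (σ.pow_pm_ne h12 hq hB hk).1) hlines
  subst hxx'
  have hP : σ.fp11 h12 hq hB t = σ.fp11 h12 hq hB t' := (σ.onPoints ^ (x : ℕ)).injective h
  refine ⟨?_, rfl⟩
  -- the pencil-1 lines through P_t = P_t'
  have g1 := σ.fp11_mem_pow_pm1 h12 hq hB t
  have g2 := σ.fp11_mem_pow_pm1 h12 hq hB t'
  rw [← hP] at g2
  have g3 := σ.tv1_mem_pow_pm1 h12 hq hB ((-t : Fin 11) : ℕ)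
  have g4 := σ.tv1_mem_pow_pm1 h12 hq hB ((-t' : Fin 11) : ℕ)
  have hne1 : σ.fp11 h12 hq hB t ≠ σ.tv1 h12 hq hB := (σ.ne_tv_of_free h12 hq hB (σ.fp11_free h12 hq hB t)).2.1
  have hl := (Nondegenerate.eq_or_eq g1 g3 g2 g4).resolve_left hne1
  have := σ.fin_eq_of_pow_pm_eq hq (fun k hk => (σ.pow_pm_ne h12 hq hB hk).2.1) hl
  exact neg_inj.1 this

omit [Fintype P] [Fintype L] in
include hq in
/-- **A free orbit meets a pencil base line once**: for `v ∈ M`, `v` fixed, `M` moved by all powers, and `p` whose orbit avoids `v`,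
`σ^a p, σ^b p ∈ M` forces `a ≡ b (mod 11)`. -/
theorem orbit_meets_once11 {v : P} {M : L} (fv : σ.onPoints v = v) (hvM : v ∈ M) (hmov : ∀ k : ℕ, ¬ 11 ∣ k → (σ.onLines ^ k) M ≠ M)
    {p : P} (hpv : ∀ k : ℕ, (σ.onPoints ^ k) p ≠ v) {a b : ℕ} (ha : (σ.onPoints ^ a) p ∈ M) (hb : (σ.onPoints ^ b) p ∈ M) :
    a % 11 = b % 11 := by
  rw [pow_apply_eq_pow_mod σ.onPoints hq a] at ha
  rw [pow_apply_eq_pow_mod σ.onPoints hq b] at hb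
  by_contra hne
  have key : ∀ c d : ℕ, c < d → d < 11 → (σ.onPoints ^ c) p ∈ M → (σ.onPoints ^ d) p ∈ M → False := by
    intro c d hcd hd hc hd'
    have h1 : (σ.onPoints ^ d) p ∈ (σ.onLines ^ (d - c)) M := by
      have := (σ.pow_mem_iff (d - c) ((σ.onPoints ^ c) p) M).2 hc
      rwa [← Equiv.Perm.mul_apply, ← pow_add, show d - c + c = d by omega] at this
    have h2 : v ∈ (σ.onLines ^ (d - c)) M := (σ.tv_mem_pow_iff fv _ M).2 hvM
    rcases Nondegenerate.eq_or_eq hd' hvM h1 h2 with e | e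
    · exact hpv d e
    · exact hmov (d - c) (by omega) e.symm
  rcases Nat.lt_or_gt_of_ne hne with hlt | hlt
  · exact key _ _ hlt (Nat.mod_lt b (by norm_num)) ha hb
  · exact key _ _ hlt (Nat.mod_lt a (by norm_num)) hb ha

/-! ### The epsilon exponents are genuine -/

/-- `phi t < 11` and `σ^{phi t} P_t ∈ M_2` -/
theorem phiN11_spec (t : Fin 11) : σ.phiN11 h12 hq hB t < 11 ∧ (σ.onPoints ^ σ.phiN11 h12 hq hB t) (σ.fp11 h12 hq hB t) ∈ σ.pm2 h12 hq hB := by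
  apply Classical.epsilon_spec (p := fun x : ℕ => x < 11 ∧ (σ.onPoints ^ x) (σ.fp11 h12 hq hB t) ∈ σ.pm2 h12 hq hB)
  have hF := σ.fp11_free h12 hq hB t
  have hF' := hF
  rw [mem_freePts] at hF'
  have h2 : σ.tv2 h12 hq hB ≠ σ.fp11 h12 hq hB t := fun e => (σ.ne_tv_of_free h12 hq hB hF).2.2 e.symm
  have hax := HasLines.mkLine_ax (L := L) h2
  obtain ⟨y, hy, hyℓ⟩ := σ.pencil2 h12 hq hB hax.1 (fun e => hF'.1 (e ▸ hax.2)) (fun e => hF'.2.1 (e ▸ hax.2))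
  refine ⟨(11 - y) % 11, Nat.mod_lt _ (by norm_num), ?_⟩
  have h := σ.pow_apply_mem_pow hq (b := (11 - y) % 11) (a := y) (p := σ.fp11 h12 hq hB t) (m := σ.pm2 h12 hq hB) (hyℓ ▸ hax.2)
  have e : ((11 - y) % 11 + y) % 11 = 0 := by omega
  rwa [e, pow_zero, Equiv.Perm.one_apply] at h

/-- `g1 s < 11` and `σ^{g1 s} Q_1 ∈ B_s` -/
theorem g1N11_spec (s : Fin 11) : σ.g1N11 h12 hq hB s < 11 ∧ (σ.onPoints ^ σ.g1N11 h12 hq hB s) (σ.sq1 h12 hq hB) ∈ σ.fb11 h12 hq hB s := by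
  apply Classical.epsilon_spec (p := fun x : ℕ => x < 11 ∧ (σ.onPoints ^ x) (σ.sq1 h12 hq hB) ∈ σ.fb11 h12 hq hB s)
  have hne := (σ.fb11_ne_sd h12 hq hB s).2.1
  have hR := HasPoints.mkPoint_ax (P := P) hne
  have F := σ.fb11_mem_freeLns h12 hq hB s
  rw [mem_freeLns] at F
  obtain ⟨x, hx, hxR⟩ := σ.side_regular11 h12 (σ.sd_fixed h12 hq hB).2.1 (σ.tv_mem_sd h12 hq hB).2.2.1 (σ.tv_mem_sd h12 hq hB).2.2.2.1
    (σ.tv_spec h12 hq hB).2.2.2.2.1 (σ.sq1_spec h12 hq hB).1 (fun k => (σ.pow_sq_ne_tv h12 hq hB k).1)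
    (fun k => (σ.pow_sq_ne_tv h12 hq hB k).2.1) (fun k hk => (σ.pow_sq_ne h12 hq hB hk).2.1) hR.2
    (fun e => F.1 (e ▸ hR.1)) (fun e => F.2.2 (e ▸ hR.1))
  exact ⟨x, hx, hxR ▸ hR.1⟩

/-- `g2 s < 11` and `σ^{g2 s} Q_2 ∈ B_s` -/
theorem g2N11_spec (s : Fin 11) : σ.g2N11 h12 hq hB s < 11 ∧ (σ.onPoints ^ σ.g2N11 h12 hq hB s) (σ.sq2 h12 hq hB) ∈ σ.fb11 h12 hq hB s := by
  apply Classical.epsilon_spec (p := fun x : ℕ => x < 11 ∧ (σ.onPoints ^ x) (σ.sq2 h12 hq hB) ∈ σ.fb11 h12 hq hB s)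
  have hne := (σ.fb11_ne_sd h12 hq hB s).2.2
  have hR := HasPoints.mkPoint_ax (P := P) hne
  have F := σ.fb11_mem_freeLns h12 hq hB s
  rw [mem_freeLns] at F
  obtain ⟨x, hx, hxR⟩ := σ.side_regular11 h12 (σ.sd_fixed h12 hq hB).2.2 (σ.tv_mem_sd h12 hq hB).2.2.2.2.1 (σ.tv_mem_sd h12 hq hB).2.2.2.2.2
    (σ.tv_spec h12 hq hB).2.2.2.1 (σ.sq2_spec h12 hq hB).1 (fun k => (σ.pow_sq_ne_tv h12 hq hB k).2.2.1)
    (fun k => (σ.pow_sq_ne_tv h12 hq hB k).2.2.2) (fun k hk => (σ.pow_sq_ne h12 hq hB hk).2.2) hR.2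
    (fun e => F.1 (e ▸ hR.1)) (fun e => F.2.1 (e ▸ hR.1))
  exact ⟨x, hx, hxR ▸ hR.1⟩

end ElevenB

end Collineation

end Summit.Ventures.DiscreteObjects.PP12
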